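import Literature.IUT.HodgeTheaters.PuncturedEllipticCoveringsArrowClaimsOfLawsNormal
import HarnessLib

/-!
# [IUTchI] §1 p. 38 — `[Π_C̲ : Π_{X̲→}] = 2l`, `[Π_C̲ : Π_{C̲→}] = l`, cartesianness DERIVED

Mochizuki, *Inter-universal Teichmüller theory I*, kurims manuscript (May 2020), §1 p. 38
[cite: Mochizuki2012, IUTchI §1 p.38] (D-0012 claim key, status disputed).  PROOF-ONLY; file B4 of the
«hA re-grounding» series (abc-iut-L5-lead RULINGS #58 (10) GO); companion of `PuncturedEllipticCoverings.lean`
(p404449) and of B1–B3 (`…ArrowClaimsOfLaws.lean` p444784, `…Index.lean` p445944, `…Normal.lean`).  No `def`,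
no instance, no new `Prop` fact.

Print (p. 38 l. 30–36): "cartesian diagrams … of finite étale cyclic coverings of hyperbolic orbicurves and open
immersions [with normal image] of profinite groups; we have `Gal(C̲→/C̲) ≅ ℤ/lℤ`, `Gal(X̲/C̲) ≅ ℤ/2ℤ`, and
`Gal(X̲→/C̲) ⥲ Gal(X̲/C̲) × Gal(C̲→/C̲) ≅ ℤ/2lℤ`."

WHAT IS PROVED (laws (L0) (L1) (L2a) (L2c) (L3) (L4) and `hι` as in B1/B2; `Δ_C̲/jKer = Δ_ε⁺ × Gal(X̲/C̲)`):
* `deltaXbar_relIndex_deltaCbar` (`[Δ_C̲ : Δ_X̲] = 2`), `CuspGalois.jKer_relIndex_deltaCbar_of_laws` (`= 2l`);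
* `CuspGalois.commutator_mem_jKer_of_mem_deltaCbar` — `Δ_C̲/jKer` is ABELIAN (B3: `Π_X̲` centralises it);
* `CuspGalois.pow_l_mem_zpowers_sup_jKer`, `CuspGalois.jKer_relIndex_galKer_of_laws` (`[galKer : jKer] = 2`: the
  image of `Gal(X̲/C̲)` — `ι̲^l`, of order `2`), `CuspGalois.galKer_inf_deltaXbar_le_jKer`;
* **`CuspGalois.piXarrow_relindex_of_laws`** (`[Π_C̲ : Π_{X̲→}] = 2l`), **`CuspGalois.piCarrow_relindex_of_laws`**
  (`[Π_C̲ : Π_{C̲→}] = l`), **`CuspGalois.cartesian_of_laws`** (`Π_{X̲→} = Π_X̲ ∩ Π_{C̲→}`) — the typed clauses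
  `piXarrow_relindex`, `piCarrow_relindex`, `cartesian` of `ArrowCoveringClaims` (cyclicity: file B5
  `…ArrowClaimsOfLawsCyclic.lean`).

HONEST FRAMING: nothing here asserts abc proved or refuted or takes a side on [IUTchIII] Cor. 3.12; a clause
derived under named laws is an implication, not a discharge of the laws; typed ≠ inhabited ≠ discharged.
-/

namespace Literature.IUT.HodgeTheaters

namespace PuncturedEllipticData

open scoped Pointwise
open Topology Literature.AnabelianGeometry.AbsoluteAnabelian

universe u

/-! ### Generic -/

section Generic

variable {G : Type*} [Group G]

/-- Normality of `N` in `L` restricts to any `A` with `N ≤ A ≤ L`. (Elementary.) [claim: Mochizuki2012, status: disputed] -/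
theorem normal_subgroupOf_of_le {N A L : Subgroup G} (hNA : N ≤ A) (hAL : A ≤ L)
    (hn : (N.subgroupOf L).Normal) : (N.subgroupOf A).Normal :=
  (Subgroup.normal_subgroupOf_iff hNA).mpr fun n a hn' ha =>
    (Subgroup.normal_subgroupOf_iff (hNA.trans hAL)).mp hn n a hn' (hAL ha)

end Generic

variable {D : PuncturedEllipticData.{u}}

/-! ### `[Δ_C̲ : Δ_X̲] = 2` and `[Δ_C̲ : jKer] = 2l` -/

/-- `Δ_X̲ = Π_X ∩ Δ_C̲`. ([IUTchI] §1 p.37) [claim: Mochizuki2012, status: disputed] -/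
theorem piX_inf_deltaCbar : D.PiX ⊓ D.DeltaCbar = D.DeltaXbar := by
  change D.PiX ⊓ (D.PiCbar ⊓ D.DeltaC) = (D.PiX ⊓ D.PiCbar) ⊓ D.DeltaC
  rw [inf_assoc]

/-- **`Gal(X̲/C̲) ≅ ℤ/2ℤ`** at the geometric level: `[Δ_C̲ : Δ_X̲] = 2`, given `ι̲ ∈ Δ_C̲ ∖ Δ_X̲`
(`[Π_C : Π_X] = 2`, `Π_X ⊴ Π_C`). ([IUTchI] §1 p.38) [claim: Mochizuki2012, status: disputed] -/
theorem deltaXbar_relIndex_deltaCbar (hι : ∃ c ∈ D.DeltaCbar, c ∉ D.DeltaXbar) :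
    D.DeltaXbar.relIndex D.DeltaCbar = 2 := by
  haveI := D.piX_normal
  rw [← D.piX_inf_deltaCbar, Subgroup.inf_relIndex_right]
  have hdvd : D.PiX.relIndex D.DeltaCbar ∣ 2 := D.index_piX ▸ Subgroup.relIndex_dvd_index_of_normal _ _
  rcases (Nat.dvd_prime Nat.prime_two).mp hdvd with h | h
  · exfalso
    obtain ⟨c, hc, hcX⟩ := hι
    exact D.not_mem_piX_of_mem_deltaCbar hc hcX (Subgroup.relIndex_eq_one.mp h hc)
  · exact h

namespace CuspGalois

variable (C : D.CuspGalois)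

include C in
/-- **`|Δ_ε⁺ × Gal(X̲/C̲)| = 2l`**: `[Δ_C̲ : jKer] = 2l`. ([IUTchI] §1 p.38) [claim: Mochizuki2012, status: disputed] -/
theorem jKer_relIndex_deltaCbar_of_laws
    (hfin : D.modLKer.relIndex D.DeltaXbar ≠ 0)
    (hgen : ∃ z ∈ D.inertia D.ε1, D.inertia D.ε1 ≤ (Subgroup.zpowers z).topologicalClosure)
    (hord : D.deltaEpsKer.relIndex (D.inertia D.ε1 ⊔ D.deltaEpsKer) = D.l)
    (hind : D.inertia D.ε1 ⊓ (D.inertia D.ε2 ⊔ D.deltaEpsKer) ≤ D.deltaEpsKer)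
    (hI3 : ∀ (x : D.Cusp), ∀ g ∈ D.PiXbar, ∀ z ∈ D.inertia x, g * z * g⁻¹ * z⁻¹ ∈ D.modLKer)
    (hL3 : ∀ c ∈ D.DeltaCbar, c ∉ D.DeltaXbar → ∀ v ∈ D.DeltaXbar,
      c * v * c⁻¹ * v ∈ D.inertia D.ε1 ⊔ D.inertia D.ε2 ⊔ D.deltaEpsKer)
    (hι : ∃ c ∈ D.DeltaCbar, c ∉ D.DeltaXbar) :
    D.jKer.relIndex D.DeltaCbar = 2 * D.l := by
  rw [← Subgroup.relIndex_mul_relIndex D.jKer D.DeltaXbar D.DeltaCbar D.jKer_le_deltaXbar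
    D.deltaXbar_le_deltaCbar, C.jKer_relindex_of_laws hfin hgen hord hind hI3 hL3 hι,
    D.deltaXbar_relIndex_deltaCbar hι, mul_comm]

/-! ### `Δ_C̲/jKer` is abelian -/

include C in
/-- `Δ_C̲/jKer = Δ_ε⁺ × Gal(X̲/C̲)` is ABELIAN: `[a, b] ∈ jKer` for `a, b ∈ Δ_C̲` (B3: `Π_X̲ ⊇ Δ_X̲` centralises it;
the two cosets of `Δ_X̲` commute). ([IUTchI] §1 p.38) [claim: Mochizuki2012, status: disputed] -/
theorem commutator_mem_jKer_of_mem_deltaCbar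
    (hI3 : ∀ (x : D.Cusp), ∀ g ∈ D.PiXbar, ∀ z ∈ D.inertia x, g * z * g⁻¹ * z⁻¹ ∈ D.modLKer)
    (hL3 : ∀ c ∈ D.DeltaCbar, c ∉ D.DeltaXbar → ∀ v ∈ D.DeltaXbar,
      c * v * c⁻¹ * v ∈ D.inertia D.ε1 ⊔ D.inertia D.ε2 ⊔ D.deltaEpsKer)
    (hι : ∃ c ∈ D.DeltaCbar, c ∉ D.DeltaXbar)
    {a b : D.PiC} (ha : a ∈ D.DeltaCbar) (hb : b ∈ D.DeltaCbar) : a * b * a⁻¹ * b⁻¹ ∈ D.jKer := by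
  by_cases haX : a ∈ D.DeltaXbar
  · exact C.conj_mul_inv_mem_jKer_of_mem_deltaCbar hI3 hL3 hι (D.deltaXbar_le_piXbar haX) hb
  by_cases hbX : b ∈ D.DeltaXbar
  · have h := C.conj_mul_inv_mem_jKer_of_mem_deltaCbar hI3 hL3 hι (D.deltaXbar_le_piXbar hbX) ha
    have e : a * b * a⁻¹ * b⁻¹ = (b * a * b⁻¹ * a⁻¹)⁻¹ := by group
    rw [e]; exact D.jKer.inv_mem h
  · -- `b = a t`, `t ∈ Δ_X̲`: `[a, a t] = a [a, t] a⁻¹ = a [t, a]⁻¹ a⁻¹`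
    have ht : a⁻¹ * b ∈ D.DeltaXbar := inv_mul_mem_deltaXbar_of_not_mem ha haX hb hbX
    have h := C.conj_mul_inv_mem_jKer_of_mem_deltaCbar hI3 hL3 hι (D.deltaXbar_le_piXbar ht) ha
    have h' := C.conj_mem_jKer_of_inertiaCentral hI3 (D.deltaCbar_le_piCbar ha) (D.jKer.inv_mem h)
    have e : a * b * a⁻¹ * b⁻¹ = a * (a⁻¹ * b * a * (a⁻¹ * b)⁻¹ * a⁻¹)⁻¹ * a⁻¹ := by group
    rw [e]; exact h'

/-! ### `[galKer : jKer] = 2`: the image of `Gal(X̲/C̲)` -/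

include C in
/-- For `δ = ι̲ a ∈ Δ_C̲ ∖ Δ_X̲` (`a ∈ Δ_X̲`): `δ^n ∈ ι̲^n · a^n · jKer` (`Δ_C̲/jKer` abelian). ([IUTchI] §1 p.38)
[claim: Mochizuki2012, status: disputed] -/
theorem mul_pow_mem_pow_mul_pow_mul_jKer
    (hI3 : ∀ (x : D.Cusp), ∀ g ∈ D.PiXbar, ∀ z ∈ D.inertia x, g * z * g⁻¹ * z⁻¹ ∈ D.modLKer)
    {c a : D.PiC} (hc : c ∈ D.DeltaCbar) (hcX : c ∉ D.DeltaXbar) (ha : a ∈ D.DeltaXbar) (n : ℕ) :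
    ∃ j ∈ D.jKer, (c * a) ^ n = c ^ n * a ^ n * j := by
  have hcC : c ∈ D.PiCbar := D.deltaCbar_le_piCbar hc
  have haC : a ∈ D.PiCbar := D.piXbar_le_piCbar (D.deltaXbar_le_piXbar ha)
  have hc' : c⁻¹ ∈ D.DeltaCbar := D.DeltaCbar.inv_mem hc
  have hcX' : c⁻¹ ∉ D.DeltaXbar := fun h => hcX (by simpa using D.DeltaXbar.inv_mem h)
  induction n with
  | zero => exact ⟨1, D.jKer.one_mem, by simp⟩
  | succ n ih =>
    obtain ⟨j, hj, hjn⟩ := ih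
    -- `k := a^{-n} ι̲⁻¹ a^n ι̲ ∈ jKer` (a generator), and the conjugates used below stay in `jKer`
    have hk : (a ^ n)⁻¹ * c⁻¹ * ((a ^ n)⁻¹)⁻¹ * c⁻¹⁻¹ ∈ D.jKer :=
      D.commutator_mem_jKer (D.DeltaXbar.inv_mem (D.DeltaXbar.pow_mem ha n)) hc' hcX'
    have hk' : a⁻¹ * ((a ^ n)⁻¹ * c⁻¹ * ((a ^ n)⁻¹)⁻¹ * c⁻¹⁻¹) * a⁻¹⁻¹ ∈ D.jKer :=
      C.conj_mem_jKer_of_inertiaCentral hI3 (D.PiCbar.inv_mem haC) hk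
    have hj' : (c * a)⁻¹ * j * (c * a)⁻¹⁻¹ ∈ D.jKer :=
      C.conj_mem_jKer_of_inertiaCentral hI3 (D.PiCbar.inv_mem (D.PiCbar.mul_mem hcC haC)) hj
    refine ⟨(a⁻¹ * ((a ^ n)⁻¹ * c⁻¹ * ((a ^ n)⁻¹)⁻¹ * c⁻¹⁻¹) * a⁻¹⁻¹) *
      ((c * a)⁻¹ * j * (c * a)⁻¹⁻¹), D.jKer.mul_mem hk' hj', ?_⟩
    rw [pow_succ, hjn, pow_succ, pow_succ]
    group

include C in
/-- `δ^l ∈ ι̲^l · jKer` for every `δ ∈ Δ_C̲`; hence `galKer ⊆ ⟨ι̲^l⟩ · jKer`. ([IUTchI] §1 p.38)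
[claim: Mochizuki2012, status: disputed] -/
theorem galKer_le_zpowers_sup_jKer
    (hI3 : ∀ (x : D.Cusp), ∀ g ∈ D.PiXbar, ∀ z ∈ D.inertia x, g * z * g⁻¹ * z⁻¹ ∈ D.modLKer)
    {c : D.PiC} (hc : c ∈ D.DeltaCbar) (hcX : c ∉ D.DeltaXbar) :
    D.galKer ≤ Subgroup.zpowers (c ^ D.l) ⊔ D.jKer := by
  refine sup_le le_sup_right ?_
  rw [Subgroup.closure_le]
  rintro _ ⟨δ, hδ, rfl⟩
  by_cases hδX : δ ∈ D.DeltaXbar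
  · exact Subgroup.mem_sup_right (D.modLKer_le_jKer (D.pow_l_mem_modLKer hδX))
  · have ha : c⁻¹ * δ ∈ D.DeltaXbar := inv_mul_mem_deltaXbar_of_not_mem hc hcX hδ hδX
    obtain ⟨j, hj, h⟩ := C.mul_pow_mem_pow_mul_pow_mul_jKer hI3 hc hcX ha D.l
    have e : δ = c * (c⁻¹ * δ) := by group
    change δ ^ D.l ∈ _
    rw [e, h, mul_assoc]
    exact Subgroup.mul_mem _ (Subgroup.mem_sup_left (Subgroup.mem_zpowers _))
      (Subgroup.mem_sup_right (D.jKer.mul_mem (D.modLKer_le_jKer (D.pow_l_mem_modLKer ha)) hj))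

/-- `ι̲^n ∈ Δ_X̲` forces `n` even (`ι̲ ∉ Δ_X̲`, `ι̲² ∈ Δ_X̲`). ([IUTchI] §1 p.38) [claim: Mochizuki2012, status: disputed] -/
theorem even_of_pow_mem_deltaXbar {c : D.PiC} (hc : c ∈ D.DeltaCbar) (hcX : c ∉ D.DeltaXbar) {n : ℕ}
    (hn : c ^ n ∈ D.DeltaXbar) : Even n := by
  by_contra hodd
  rw [Nat.not_even_iff_odd] at hodd
  obtain ⟨m, rfl⟩ := hodd
  have hcc : c * c ∈ D.DeltaXbar :=
    ⟨⟨Subgroup.mul_self_mem_of_index_two D.index_piX c, D.PiCbar.mul_mem hc.1 hc.1⟩,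
      D.DeltaC.mul_mem hc.2 hc.2⟩
  have h2m : c ^ (2 * m) ∈ D.DeltaXbar := by rw [pow_mul, pow_two]; exact D.DeltaXbar.pow_mem hcc m
  apply hcX
  have e : c = (c ^ (2 * m))⁻¹ * c ^ (2 * m + 1) := by rw [pow_succ, inv_mul_cancel_left]
  rw [e]
  exact D.DeltaXbar.mul_mem (D.DeltaXbar.inv_mem h2m) hn

include C in
/-- **`[galKer : jKer] = 2`**: the image of `Gal(X̲/C̲)` in `J_C`, generated by the class of `ι̲^l`, of order `2`
(`(ι̲^l)² = (ι̲²)^l ∈ Ker(Δ_X̲ ↠ Δ_X̲^{ab} ⊗ ℤ/l)`; `ι̲^{ld} ∈ jKer ⊆ Δ_X̲` forces `d` even, `l` being odd).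
([IUTchI] §1 p.38) [claim: Mochizuki2012, status: disputed] -/
theorem jKer_relIndex_galKer_of_laws
    (hI3 : ∀ (x : D.Cusp), ∀ g ∈ D.PiXbar, ∀ z ∈ D.inertia x, g * z * g⁻¹ * z⁻¹ ∈ D.modLKer)
    (hι : ∃ c ∈ D.DeltaCbar, c ∉ D.DeltaXbar) : D.jKer.relIndex D.galKer = 2 := by
  obtain ⟨c, hc, hcX⟩ := hι
  have hjG : D.jKer ≤ D.galKer := le_sup_left
  have hnorm : (D.jKer.subgroupOf D.galKer).Normal :=
    normal_subgroupOf_of_le hjG D.galKer_le_piCbar' (C.jKer_normal_of_inertiaCentral hI3)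
  have hcl : c ^ D.l ∈ D.galKer :=
    Subgroup.mem_sup_right (Subgroup.subset_closure ⟨c, hc, rfl⟩)
  have hcc : c * c ∈ D.DeltaXbar :=
    ⟨⟨Subgroup.mul_self_mem_of_index_two D.index_piX c, D.PiCbar.mul_mem hc.1 hc.1⟩,
      D.DeltaC.mul_mem hc.2 hc.2⟩
  have hodd : Odd D.l := Nat.coprime_two_left.mp
    (Nat.Coprime.coprime_dvd_left (by norm_num : 2 ∣ 6) D.coprime_six.symm)
  refine relIndex_eq_of_le_zpowers_sup hjG hnorm hcl (C.galKer_le_zpowers_sup_jKer hI3 hc hcX) ?_ ?_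
  · -- `(ι̲^l)^2 = (ι̲ ι̲)^l ∈ Ker(Δ_X̲ ↠ Δ_X̲^{ab} ⊗ ℤ/l) ⊆ jKer`
    rw [← pow_mul, mul_comm, pow_mul, pow_two]
    exact D.modLKer_le_jKer (D.pow_l_mem_modLKer hcc)
  · intro d hd
    rw [← pow_mul] at hd
    have hev := even_of_pow_mem_deltaXbar hc hcX (D.jKer_le_deltaXbar hd)
    rcases Nat.even_or_odd d with h | h
    · exact h.two_dvd
    · exact absurd hev (Nat.not_even_iff_odd.mpr (hodd.mul h))

include C in
/-- `galKer ∩ Δ_X̲ ⊆ jKer` (the `Gal(X̲/C̲)`-coset of `J_C` misses `J_X`). ([IUTchI] §1 p.38)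
[claim: Mochizuki2012, status: disputed] -/
theorem galKer_inf_deltaXbar_le_jKer
    (hI3 : ∀ (x : D.Cusp), ∀ g ∈ D.PiXbar, ∀ z ∈ D.inertia x, g * z * g⁻¹ * z⁻¹ ∈ D.modLKer)
    (hι : ∃ c ∈ D.DeltaCbar, c ∉ D.DeltaXbar) : D.galKer ⊓ D.DeltaXbar ≤ D.jKer := by
  obtain ⟨c, hc, hcX⟩ := hι
  rintro m ⟨hm, hmX⟩
  have hjG : D.jKer ≤ D.galKer := le_sup_left
  have hcl : c ^ D.l ∈ D.galKer := Subgroup.mem_sup_right (Subgroup.subset_closure ⟨c, hc, rfl⟩)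
  have hnorm : (D.jKer.subgroupOf D.galKer).Normal :=
    normal_subgroupOf_of_le hjG D.galKer_le_piCbar' (C.jKer_normal_of_inertiaCentral hI3)
  obtain ⟨w, hw, j, hj, rfl⟩ := exists_mul_eq_of_mem_sup_of_normal_subgroupOf
    (Subgroup.zpowers_le.mpr hcl) hjG hnorm (C.galKer_le_zpowers_sup_jKer hI3 hc hcX hm)
  obtain ⟨e, rfl⟩ := Subgroup.mem_zpowers_iff.mp hw
  have hwX : (c ^ D.l) ^ e ∈ D.DeltaXbar := by
    have := D.DeltaXbar.mul_mem hmX (D.DeltaXbar.inv_mem (D.jKer_le_deltaXbar hj))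
    simpa only [mul_inv_cancel_right] using this
  refine D.jKer.mul_mem ?_ hj
  have hcc : c * c ∈ D.DeltaXbar :=
    ⟨⟨Subgroup.mul_self_mem_of_index_two D.index_piX c, D.PiCbar.mul_mem hc.1 hc.1⟩,
      D.DeltaC.mul_mem hc.2 hc.2⟩
  have hsq : (c ^ D.l) ^ (2 : ℤ) ∈ D.jKer := by
    rw [zpow_ofNat, ← pow_mul, mul_comm, pow_mul, pow_two]
    exact D.modLKer_le_jKer (D.pow_l_mem_modLKer hcc)
  have hodd : Odd D.l := Nat.coprime_two_left.mp
    (Nat.Coprime.coprime_dvd_left (by norm_num : 2 ∣ 6) D.coprime_six.symm)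
  rcases Int.even_or_odd e with ⟨t, rfl⟩ | ⟨t, rfl⟩
  · rw [← two_mul, zpow_mul]
    exact D.jKer.zpow_mem hsq t
  · exfalso
    -- `(ι̲^l)^(2t+1) ∈ Δ_X̲` gives `ι̲^l ∈ Δ_X̲`, contradicting `l` odd
    have h1 : (c ^ D.l) ^ (2 * t) ∈ D.DeltaXbar := by
      rw [zpow_mul]; exact D.DeltaXbar.zpow_mem (D.jKer_le_deltaXbar hsq) t
    have h2 : c ^ D.l ∈ D.DeltaXbar := by
      have := D.DeltaXbar.mul_mem (D.DeltaXbar.inv_mem h1) hwX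
      rwa [zpow_add, zpow_one, inv_mul_cancel_left] at this
    obtain ⟨q, hq⟩ := hodd
    exact Nat.not_even_iff_odd.mpr ⟨q, hq⟩ (even_of_pow_mem_deltaXbar hc hcX h2)

/-! ### The indices `[Π_C̲ : Π_{X̲→}] = 2l`, `[Π_C̲ : Π_{C̲→}] = l` -/

include C in
/-- `Π_{X̲→} ∩ Δ_C̲ = jKer`. ([IUTchI] §1 p.38) [claim: Mochizuki2012, status: disputed] -/
theorem piXarrow_inf_deltaCbar_of_inertiaCentral
    (hI3 : ∀ (x : D.Cusp), ∀ g ∈ D.PiXbar, ∀ z ∈ D.inertia x, g * z * g⁻¹ * z⁻¹ ∈ D.modLKer) :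
    D.piXarrow ⊓ D.DeltaCbar = D.jKer := by
  rw [← C.piXarrow_inf_deltaC_of_inertiaCentral hI3]
  change D.piXarrow ⊓ (D.PiCbar ⊓ D.DeltaC) = _
  rw [← inf_assoc, inf_eq_left.mpr D.piXarrow_le_piCbar]

include C in
/-- `Π_{C̲→} ∩ Δ_C̲ = galKer`. ([IUTchI] §1 p.38) [claim: Mochizuki2012, status: disputed] -/
theorem piCarrow_inf_deltaCbar_of_inertiaCentral
    (hI3 : ∀ (x : D.Cusp), ∀ g ∈ D.PiXbar, ∀ z ∈ D.inertia x, g * z * g⁻¹ * z⁻¹ ∈ D.modLKer) :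
    D.piCarrow ⊓ D.DeltaCbar = D.galKer := by
  rw [← C.piCarrow_inf_deltaC_of_inertiaCentral hI3]
  change D.piCarrow ⊓ (D.PiCbar ⊓ D.DeltaC) = _
  rw [← inf_assoc, inf_eq_left.mpr D.piCarrow_le_piCbar]

/-- If `P ⊴ Π_C̲` contains `Π_{X̲→}`, then `[Π_C̲ : P] = [Δ_C̲ : P ∩ Δ_C̲]` (`Π_C̲ = Π_{X̲→} · Δ_C̲`).
([IUTchI] §1 p.38) [claim: Mochizuki2012, status: disputed] -/
theorem relIndex_piCbar_eq_of_normal {P : Subgroup D.PiC} (hP : P ≤ D.PiCbar) (hXP : D.piXarrow ≤ P)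
    (hn : (P.subgroupOf D.PiCbar).Normal) : P.relIndex D.PiCbar = (P ⊓ D.DeltaCbar).relIndex D.DeltaCbar := by
  haveI := hn
  have htop : D.DeltaCbar.subgroupOf D.PiCbar ⊔ P.subgroupOf D.PiCbar = ⊤ := by
    rw [eq_top_iff]
    rintro ⟨g, hg⟩ -
    obtain ⟨p, hp, δ, hδ, hpδ⟩ := D.exists_piXarrow_mul_deltaCbar hg
    have e : (⟨g, hg⟩ : ↥D.PiCbar) = ⟨p, hP (hXP hp)⟩ * ⟨δ, D.deltaCbar_le_piCbar hδ⟩ :=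
      Subtype.ext hpδ.symm
    rw [e, sup_comm]
    exact Subgroup.mul_mem_sup (Subgroup.mem_subgroupOf.mpr (hXP hp)) (Subgroup.mem_subgroupOf.mpr hδ)
  have h := Subgroup.relIndex_sup_right (D.DeltaCbar.subgroupOf D.PiCbar) (P.subgroupOf D.PiCbar)
  rw [htop, Subgroup.relIndex_top_right, Subgroup.relIndex_subgroupOf D.deltaCbar_le_piCbar,
    ← Subgroup.inf_relIndex_right P D.DeltaCbar] at h
  exact h

include C in
/-- **[IUTchI] §1 p. 38 — the typed clause `ArrowCoveringClaims.piXarrow_relindex` (`Gal(X̲→/C̲) ≅ ℤ/2lℤ`: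
`[Π_C̲ : Π_{X̲→}] = 2l`) DERIVED.** ([IUTchI] §1 p.38) [claim: Mochizuki2012, status: disputed] -/
theorem piXarrow_relindex_of_laws
    (hfin : D.modLKer.relIndex D.DeltaXbar ≠ 0)
    (hgen : ∃ z ∈ D.inertia D.ε1, D.inertia D.ε1 ≤ (Subgroup.zpowers z).topologicalClosure)
    (hord : D.deltaEpsKer.relIndex (D.inertia D.ε1 ⊔ D.deltaEpsKer) = D.l)
    (hind : D.inertia D.ε1 ⊓ (D.inertia D.ε2 ⊔ D.deltaEpsKer) ≤ D.deltaEpsKer)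
    (hI3 : ∀ (x : D.Cusp), ∀ g ∈ D.PiXbar, ∀ z ∈ D.inertia x, g * z * g⁻¹ * z⁻¹ ∈ D.modLKer)
    (hL3 : ∀ c ∈ D.DeltaCbar, c ∉ D.DeltaXbar → ∀ v ∈ D.DeltaXbar,
      c * v * c⁻¹ * v ∈ D.inertia D.ε1 ⊔ D.inertia D.ε2 ⊔ D.deltaEpsKer)
    (hι : ∃ c ∈ D.DeltaCbar, c ∉ D.DeltaXbar) :
    D.piXarrow.relIndex D.PiCbar = 2 * D.l := by
  rw [relIndex_piCbar_eq_of_normal D.piXarrow_le_piCbar le_rfl (C.piXarrow_normal_of_laws hI3 hL3 hι),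
    C.piXarrow_inf_deltaCbar_of_inertiaCentral hI3, C.jKer_relIndex_deltaCbar_of_laws hfin hgen hord hind hI3 hL3 hι]

include C in
/-- **[IUTchI] §1 p. 38 — the typed clause `ArrowCoveringClaims.piCarrow_relindex` (`Gal(C̲→/C̲) ≅ ℤ/lℤ`:
`[Π_C̲ : Π_{C̲→}] = l`) DERIVED.** ([IUTchI] §1 p.38) [claim: Mochizuki2012, status: disputed] -/
theorem piCarrow_relindex_of_laws
    (hfin : D.modLKer.relIndex D.DeltaXbar ≠ 0)
    (hgen : ∃ z ∈ D.inertia D.ε1, D.inertia D.ε1 ≤ (Subgroup.zpowers z).topologicalClosure)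
    (hord : D.deltaEpsKer.relIndex (D.inertia D.ε1 ⊔ D.deltaEpsKer) = D.l)
    (hind : D.inertia D.ε1 ⊓ (D.inertia D.ε2 ⊔ D.deltaEpsKer) ≤ D.deltaEpsKer)
    (hI3 : ∀ (x : D.Cusp), ∀ g ∈ D.PiXbar, ∀ z ∈ D.inertia x, g * z * g⁻¹ * z⁻¹ ∈ D.modLKer)
    (hL3 : ∀ c ∈ D.DeltaCbar, c ∉ D.DeltaXbar → ∀ v ∈ D.DeltaXbar,
      c * v * c⁻¹ * v ∈ D.inertia D.ε1 ⊔ D.inertia D.ε2 ⊔ D.deltaEpsKer)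
    (hι : ∃ c ∈ D.DeltaCbar, c ∉ D.DeltaXbar) :
    D.piCarrow.relIndex D.PiCbar = D.l := by
  rw [relIndex_piCbar_eq_of_normal D.piCarrow_le_piCbar D.piXarrow_le_piCarrow
    (C.piCarrow_normal_of_laws hI3 hL3 hι), C.piCarrow_inf_deltaCbar_of_inertiaCentral hI3]
  have h := Subgroup.relIndex_mul_relIndex D.jKer D.galKer D.DeltaCbar le_sup_left D.galKer_le_deltaCbar
  rw [C.jKer_relIndex_galKer_of_laws hI3 hι, C.jKer_relIndex_deltaCbar_of_laws hfin hgen hord hind hI3 hL3 hι]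
    at h
  exact Nat.eq_of_mul_eq_mul_left (by norm_num : 0 < 2) h

/-! ### Cartesianness -/

include C in
/-- **[IUTchI] §1 p. 38 — the typed clause `ArrowCoveringClaims.cartesian` (`Π_{X̲→} = Π_X̲ ∩ Π_{C̲→}`:
"natural cartesian diagrams") DERIVED.** ([IUTchI] §1 p.38) [claim: Mochizuki2012, status: disputed] -/
theorem cartesian_of_laws
    (hI3 : ∀ (x : D.Cusp), ∀ g ∈ D.PiXbar, ∀ z ∈ D.inertia x, g * z * g⁻¹ * z⁻¹ ∈ D.modLKer)
    (hι : ∃ c ∈ D.DeltaCbar, c ∉ D.DeltaXbar) : D.piXarrow = D.PiXbar ⊓ D.piCarrow := by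
  refine le_antisymm D.piXarrow_le_inf ?_
  rintro x ⟨hxX, hxC⟩
  obtain ⟨d, hd, m, hm, rfl⟩ := exists_mul_eq_of_mem_sup_of_normal_subgroupOf
    ((D.decomp_le D.twoε).trans inf_le_right) D.galKer_le_piCbar'
    (D.galKer_normal_subgroupOf (C.jKer_normal_of_inertiaCentral hI3)) hxC
  have hmXb : m ∈ D.PiXbar := by
    have := D.PiXbar.mul_mem (D.PiXbar.inv_mem (D.decomp_le D.twoε hd)) hxX
    simpa only [inv_mul_cancel_left] using this
  have hmX : m ∈ D.DeltaXbar := Subgroup.mem_inf.mpr ⟨hmXb, (D.galKer_le_deltaCbar hm).2⟩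
  have hjP : D.jKer ≤ D.piXarrow := D.jKer_le_piXarrow_inf_delta.trans inf_le_left
  exact D.piXarrow.mul_mem (D.decomp_twoε_le_piXarrow hd)
    (hjP (C.galKer_inf_deltaXbar_le_jKer hI3 hι ⟨hm, hmX⟩))

end CuspGalois

end PuncturedEllipticData

end Literature.IUT.HodgeTheaters
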